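import Mathlib

/-!
# Finite conditional expectations along a class kernel (pinning-lemma toolkit, I)

Route `PlantedPinning` of `Ising3DConformalLimit`, support item stmt-CriticalPhenomena-8455
(`PinningEfficiencyLeOne`).  Elementary finite-probability layer of the pinning lemma
(Montanari 2008; Raghavendra–Tan 2012).  Data: a finite type `Ω`, strictly positive weights `w`,
and a *class kernel* `K : Ω → Ω → ℝ`, the `0/1` indicator of an equivalence relation ("same
pinned pattern"): `K a b ∈ {0,1}`, `K a a = 1`, `K a b = K b a`, `K a b = 1 → K b c = 1 → K a c = 1`.
The conditional expectation is any operator `E` satisfying the defining equation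
`E f ω = (∑ ω', K ω ω' w ω' f ω') / ∑ ω', K ω ω' w ω'` (hypothesis `hE`; no definitions are
introduced, so that users instantiate `E` by a lambda and `hE` by `rfl`).  We prove linearity,
pull-out of class-invariant factors, self-adjointness `∑ w g (E f) = ∑ w g f` for invariant `g`,
the tower property for a finer kernel, conditional Cauchy–Schwarz against a sign, and the
**one-pin variance-drop inequality** `∑ w · Cov(M, s | K)² ≤ 𝔼 Var(M | K) − 𝔼 Var(M | K')`
(`sum_condCov_sq_le_vbar_sub`).  Everything is a finite-sum identity.
-/

namespace Summit.CriticalPhenomena.Ising3DConformalLimit.PlantedPinningCeiling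

open Finset

variable {Ω : Type*} [Fintype Ω]

/-! ### Class kernels and class sums -/

section KSum

variable (w : Ω → ℝ) (K : Ω → Ω → ℝ)

omit [Fintype Ω] in
/-- Rows of a class kernel agree on a class: `K a b = 1 → K a c = K b c`. [folklore] -/
theorem kernel_row_eq (h01 : ∀ a b, K a b = 0 ∨ K a b = 1) (hsymm : ∀ a b, K a b = K b a)
    (htrans : ∀ a b c, K a b = 1 → K b c = 1 → K a c = 1) {a b : Ω} (hab : K a b = 1) (c : Ω) :
    K a c = K b c := by
  have hba : K b a = 1 := by rw [hsymm]; exact hab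
  rcases h01 a c with hac | hac <;> rcases h01 b c with hbc | hbc
  · rw [hac, hbc]
  · rw [htrans a b c hab hbc] at hac; exact absurd hac one_ne_zero
  · rw [htrans b a c hba hac] at hbc; exact absurd hbc one_ne_zero
  · rw [hac, hbc]

/-- Class sums of a linear combination `a f + b g + c`. [folklore] -/
theorem ksum_linear {f g k : Ω → ℝ} {a b c : ℝ} (hk : ∀ ω, k ω = a * f ω + b * g ω + c) (ω : Ω) :
    ∑ ω', K ω ω' * w ω' * k ω' = a * ∑ ω', K ω ω' * w ω' * f ω' +
      b * ∑ ω', K ω ω' * w ω' * g ω' + c * ∑ ω', K ω ω' * w ω' := by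
  rw [Finset.mul_sum, Finset.mul_sum, Finset.mul_sum, ← Finset.sum_add_distrib,
    ← Finset.sum_add_distrib]
  exact Finset.sum_congr rfl fun ω' _ => by rw [hk ω']; ring

/-- **Pull-out**: a class-invariant factor leaves the class sum. [folklore] -/
theorem ksum_mul_of_invariant (h01 : ∀ a b, K a b = 0 ∨ K a b = 1) {g : Ω → ℝ}
    (hg : ∀ a b, K a b = 1 → g a = g b) (f : Ω → ℝ) (ω : Ω) :
    ∑ ω', K ω ω' * w ω' * (f ω' * g ω') = (∑ ω', K ω ω' * w ω' * f ω') * g ω := by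
  rw [Finset.sum_mul]
  refine Finset.sum_congr rfl fun ω' _ => ?_
  rcases h01 ω ω' with h | h
  · rw [h]; ring
  · rw [hg _ _ h]; ring

/-- Class sums of nonnegative functions are nonnegative. [folklore] -/
theorem ksum_nonneg (hw : ∀ ω, 0 ≤ w ω) (h01 : ∀ a b, K a b = 0 ∨ K a b = 1) {f : Ω → ℝ}
    (hf : ∀ ω, 0 ≤ f ω) (ω : Ω) : 0 ≤ ∑ ω', K ω ω' * w ω' * f ω' := by
  refine Finset.sum_nonneg fun ω' _ => mul_nonneg (mul_nonneg ?_ (hw ω')) (hf ω')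
  rcases h01 ω ω' with h | h <;> simp [h]

/-- The class weight is positive. [folklore] -/
theorem ksum_one_pos (hw : ∀ ω, 0 < w ω) (h01 : ∀ a b, K a b = 0 ∨ K a b = 1)
    (hrefl : ∀ a, K a a = 1) (ω : Ω) : 0 < ∑ ω', K ω ω' * w ω' := by
  have hle : K ω ω * w ω ≤ ∑ ω', K ω ω' * w ω' :=
    Finset.single_le_sum (f := fun ω' => K ω ω' * w ω')
      (fun ω' _ => mul_nonneg (by rcases h01 ω ω' with h | h <;> simp [h]) (hw ω').le)
      (Finset.mem_univ ω)
  rw [hrefl ω, one_mul] at hle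
  exact lt_of_lt_of_le (hw ω) hle

/-- Class sums are constant on classes. [folklore] -/
theorem ksum_congr_row {a b : Ω} (hrow : ∀ c, K a c = K b c) (f : Ω → ℝ) :
    ∑ ω', K a ω' * w ω' * f ω' = ∑ ω', K b ω' * w ω' * f ω' :=
  Finset.sum_congr rfl fun ω' _ => by rw [hrow ω']

/-- **Symmetry of the class-sum bilinear form** for a symmetric kernel. [folklore] -/
theorem sum_mul_ksum_comm (hsymm : ∀ a b, K a b = K b a) (f g : Ω → ℝ) :
    ∑ ω, w ω * g ω * ∑ ω', K ω ω' * w ω' * f ω' =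
      ∑ ω, w ω * f ω * ∑ ω', K ω ω' * w ω' * g ω' := by
  simp_rw [Finset.mul_sum]
  rw [Finset.sum_comm]
  exact Finset.sum_congr rfl fun a _ => Finset.sum_congr rfl fun b _ => by rw [hsymm b a]; ring

/-- Class sums of a finite sum of functions. [folklore] -/
theorem ksum_finset_sum {ι : Type*} (t : Finset ι) (g : ι → Ω → ℝ) (ω : Ω) :
    ∑ ω', K ω ω' * w ω' * (∑ i ∈ t, g i ω') = ∑ i ∈ t, ∑ ω', K ω ω' * w ω' * g i ω' := by
  rw [Finset.sum_comm]
  exact Finset.sum_congr rfl fun ω' _ => by rw [Finset.mul_sum]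

end KSum

/-! ### Conditional expectations -/

section CExp

variable (w : Ω → ℝ) (K : Ω → Ω → ℝ) {E : (Ω → ℝ) → Ω → ℝ}
  (hE : ∀ f ω, E f ω = (∑ ω', K ω ω' * w ω' * f ω') / ∑ ω', K ω ω' * w ω')
include hE

/-- Conditional expectation of a linear combination `a f + b g + c`. [folklore] -/
theorem cexp_linear (hZ : ∀ ω, ∑ ω', K ω ω' * w ω' ≠ 0) {f g k : Ω → ℝ} {a b c : ℝ}
    (hk : ∀ ω, k ω = a * f ω + b * g ω + c) (ω : Ω) :
    E k ω = a * E f ω + b * E g ω + c := by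
  rw [hE, hE, hE, ksum_linear w K hk ω]
  field_simp [hZ ω]

/-- Conditional expectation of a difference. [folklore] -/
theorem cexp_sub (f g : Ω → ℝ) (ω : Ω) : E (fun ω => f ω - g ω) ω = E f ω - E g ω := by
  rw [hE, hE, hE, ← sub_div, ← Finset.sum_sub_distrib]
  congr 1
  exact Finset.sum_congr rfl fun ω' _ => by ring

/-- Conditional expectation of a finite sum of functions. [folklore] -/
theorem cexp_finset_sum {ι : Type*} (t : Finset ι) (g : ι → Ω → ℝ) (ω : Ω) :
    E (fun ω => ∑ i ∈ t, g i ω) ω = ∑ i ∈ t, E (g i) ω := by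
  rw [hE, ksum_finset_sum, Finset.sum_div]
  exact Finset.sum_congr rfl fun i _ => by rw [hE]

/-- **Pull-out** of a class-invariant factor. [folklore] -/
theorem cexp_mul_of_invariant (h01 : ∀ a b, K a b = 0 ∨ K a b = 1) {g : Ω → ℝ}
    (hg : ∀ a b, K a b = 1 → g a = g b) (f : Ω → ℝ) (ω : Ω) :
    E (fun ω => f ω * g ω) ω = E f ω * g ω := by
  rw [hE, hE, ksum_mul_of_invariant w K h01 hg, mul_comm, mul_div_assoc, mul_comm]

/-- A class-invariant function is its own conditional expectation. [folklore] -/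
theorem cexp_of_invariant (hZ : ∀ ω, ∑ ω', K ω ω' * w ω' ≠ 0) (h01 : ∀ a b, K a b = 0 ∨ K a b = 1)
    {g : Ω → ℝ} (hg : ∀ a b, K a b = 1 → g a = g b) (ω : Ω) : E g ω = g ω := by
  have h := ksum_mul_of_invariant w K h01 hg (fun _ => 1) ω
  simp only [one_mul, mul_one] at h
  rw [hE, h, mul_comm, mul_div_assoc, div_self (hZ ω), mul_one]

/-- Conditional expectations are constant on classes. [folklore] -/
theorem cexp_congr_row {a b : Ω} (hrow : ∀ c, K a c = K b c) (f : Ω → ℝ) : E f a = E f b := by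
  rw [hE, hE, ksum_congr_row w K hrow]
  congr 1
  exact Finset.sum_congr rfl fun ω' _ => by rw [hrow ω']

/-- Conditional expectations of nonnegative functions are nonnegative. [folklore] -/
theorem cexp_nonneg (hw : ∀ ω, 0 ≤ w ω) (h01 : ∀ a b, K a b = 0 ∨ K a b = 1) {f : Ω → ℝ}
    (hf : ∀ ω, 0 ≤ f ω) (ω : Ω) : 0 ≤ E f ω := by
  rw [hE]
  refine div_nonneg (ksum_nonneg w K hw h01 hf ω) ?_
  have := ksum_nonneg w K hw h01 (f := fun _ => 1) (fun _ => zero_le_one) ω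
  simpa only [mul_one] using this

/-- **Self-adjointness / tower against invariant test functions**:
`∑ w g (E f) = ∑ w g f` for class-invariant `g`. [folklore] -/
theorem sum_mul_cexp (hw : ∀ ω, 0 < w ω) (h01 : ∀ a b, K a b = 0 ∨ K a b = 1)
    (hrefl : ∀ a, K a a = 1) (hsymm : ∀ a b, K a b = K b a)
    (htrans : ∀ a b c, K a b = 1 → K b c = 1 → K a c = 1)
    {g : Ω → ℝ} (hg : ∀ a b, K a b = 1 → g a = g b) (f : Ω → ℝ) :
    ∑ ω, w ω * g ω * E f ω = ∑ ω, w ω * g ω * f ω := by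
  have hZpos : ∀ ω, 0 < ∑ ω', K ω ω' * w ω' := fun ω => ksum_one_pos w K hw h01 hrefl ω
  have hZinv : ∀ a b, K a b = 1 → ∑ ω', K a ω' * w ω' = ∑ ω', K b ω' * w ω' := fun a b hab =>
    Finset.sum_congr rfl fun c _ => by rw [kernel_row_eq K h01 hsymm htrans hab c]
  -- the rescaled test function `g / Z` is invariant
  set g' : Ω → ℝ := fun ω => g ω / ∑ ω', K ω ω' * w ω' with hg'def
  have hg' : ∀ a b, K a b = 1 → g' a = g' b := fun a b hab => by
    simp only [hg'def, hg a b hab, hZinv a b hab]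
  have h1 : ∀ ω, w ω * g ω * E f ω = w ω * g' ω * ∑ ω', K ω ω' * w ω' * f ω' := fun ω => by
    rw [hE, hg'def]
    ring
  have h2 : ∀ ω, w ω * f ω * (∑ ω', K ω ω' * w ω' * g' ω') = w ω * g ω * f ω := fun ω => by
    have h := ksum_mul_of_invariant w K h01 hg' (fun _ => 1) ω
    simp only [one_mul, mul_one] at h
    rw [h, hg'def]
    field_simp [(hZpos ω).ne']
  rw [Finset.sum_congr rfl (fun ω _ => h1 ω), sum_mul_ksum_comm w K hsymm f g',
    Finset.sum_congr rfl (fun ω _ => h2 ω)]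

/-- `∑ w (E f) = ∑ w f`. [folklore] -/
theorem sum_w_mul_cexp (hw : ∀ ω, 0 < w ω) (h01 : ∀ a b, K a b = 0 ∨ K a b = 1)
    (hrefl : ∀ a, K a a = 1) (hsymm : ∀ a b, K a b = K b a)
    (htrans : ∀ a b c, K a b = 1 → K b c = 1 → K a c = 1) (f : Ω → ℝ) :
    ∑ ω, w ω * E f ω = ∑ ω, w ω * f ω := by
  have := sum_mul_cexp w K hE hw h01 hrefl hsymm htrans (g := fun _ => (1:ℝ)) (fun _ _ _ => rfl) f
  simpa only [mul_one] using this

/-- **Conditional Cauchy–Schwarz against a sign**: if `s² = 1` then `(E (f s))² ≤ E (f²)`.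
[folklore] -/
theorem cexp_mul_sign_sq_le (hw : ∀ ω, 0 < w ω) (h01 : ∀ a b, K a b = 0 ∨ K a b = 1)
    (hrefl : ∀ a, K a a = 1) {s : Ω → ℝ} (hs : ∀ ω, s ω ^ 2 = 1) (f : Ω → ℝ) (ω : Ω) :
    (E (fun ω => f ω * s ω) ω) ^ 2 ≤ E (fun ω => f ω ^ 2) ω := by
  have hZ : ∀ ω, ∑ ω', K ω ω' * w ω' ≠ 0 := fun ω => (ksum_one_pos w K hw h01 hrefl ω).ne'
  set c := E (fun ω => f ω * s ω) ω with hc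
  have hk : ∀ ω', (fun ω => (f ω - c * s ω) ^ 2) ω' =
      1 * (f ω' ^ 2) + (-2 * c) * (f ω' * s ω') + c ^ 2 := fun ω' => by
    have h1 := hs ω'
    simp only
    calc (f ω' - c * s ω') ^ 2 = f ω' ^ 2 - 2 * c * (f ω' * s ω') + c ^ 2 * s ω' ^ 2 := by ring
      _ = _ := by rw [h1]; ring
  have hexp := cexp_linear w K hE hZ hk ω
  have hnonneg : 0 ≤ E (fun ω => (f ω - c * s ω) ^ 2) ω :=
    cexp_nonneg w K hE (fun ω => (hw ω).le) h01 (fun ω => sq_nonneg _) ω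
  rw [hexp, ← hc] at hnonneg
  nlinarith [hnonneg]

/-- `𝔼 Var(M | K) = 𝔼 M² − 𝔼 (E M)²`. [folklore] -/
theorem vbar_eq (hw : ∀ ω, 0 < w ω) (h01 : ∀ a b, K a b = 0 ∨ K a b = 1)
    (hrefl : ∀ a, K a a = 1) (hsymm : ∀ a b, K a b = K b a)
    (htrans : ∀ a b c, K a b = 1 → K b c = 1 → K a c = 1) (M : Ω → ℝ) :
    ∑ ω, w ω * (E (fun ω => M ω ^ 2) ω - (E M ω) ^ 2) =
      ∑ ω, w ω * M ω ^ 2 - ∑ ω, w ω * (E M ω) ^ 2 := by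
  simp only [mul_sub, Finset.sum_sub_distrib]
  rw [sum_w_mul_cexp w K hE hw h01 hrefl hsymm htrans]

/-- The expected conditional variance `∑ w (E (M²) − (E M)²)` is nonnegative. [folklore] -/
theorem vbar_nonneg (hw : ∀ ω, 0 < w ω) (h01 : ∀ a b, K a b = 0 ∨ K a b = 1)
    (hrefl : ∀ a, K a a = 1) (M : Ω → ℝ) :
    0 ≤ ∑ ω, w ω * (E (fun ω => M ω ^ 2) ω - (E M ω) ^ 2) := by
  refine Finset.sum_nonneg fun ω _ => mul_nonneg (hw ω).le ?_
  have := cexp_mul_sign_sq_le w K hE hw h01 hrefl (s := fun _ => (1:ℝ)) (fun _ => by norm_num) M ω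
  simp only [mul_one] at this
  linarith

end CExp

/-! ### The one-pin variance drop -/

section Drop

variable (w : Ω → ℝ) (K K' : Ω → Ω → ℝ) {E E' : (Ω → ℝ) → Ω → ℝ}

/-- **One-pin variance drop** (the "binary one-pin identity + Cauchy–Schwarz" step of the
pinning lemma, Raghavendra–Tan 2012; Montanari 2008): if the class kernel `K'` refines `K` and `s`
is a `K'`-invariant sign (`s² = 1`), then
`∑_ω w(ω) Cov(M, s | K)(ω)² ≤ 𝔼 Var(M | K) − 𝔼 Var(M | K')`. [folklore] -/
theorem sum_condCov_sq_le_vbar_sub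
    (hE : ∀ f ω, E f ω = (∑ ω', K ω ω' * w ω' * f ω') / ∑ ω', K ω ω' * w ω')
    (hE' : ∀ f ω, E' f ω = (∑ ω', K' ω ω' * w ω' * f ω') / ∑ ω', K' ω ω' * w ω')
    (hw : ∀ ω, 0 < w ω)
    (h01 : ∀ a b, K a b = 0 ∨ K a b = 1) (hrefl : ∀ a, K a a = 1) (hsymm : ∀ a b, K a b = K b a)
    (htrans : ∀ a b c, K a b = 1 → K b c = 1 → K a c = 1)
    (h01' : ∀ a b, K' a b = 0 ∨ K' a b = 1) (hrefl' : ∀ a, K' a a = 1)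
    (hsymm' : ∀ a b, K' a b = K' b a) (htrans' : ∀ a b c, K' a b = 1 → K' b c = 1 → K' a c = 1)
    (href : ∀ a b, K' a b = 1 → K a b = 1)
    (M s : Ω → ℝ) (hs : ∀ ω, s ω ^ 2 = 1) (hsinv : ∀ a b, K' a b = 1 → s a = s b) :
    ∑ ω, w ω * (E (fun ω => M ω * s ω) ω - E M ω * E s ω) ^ 2 ≤
      ∑ ω, w ω * (E (fun ω => M ω ^ 2) ω - (E M ω) ^ 2) -
        ∑ ω, w ω * (E' (fun ω => M ω ^ 2) ω - (E' M ω) ^ 2) := by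
  set D : Ω → ℝ := fun ω => E' M ω - E M ω with hD
  have hEMinv : ∀ a b, K a b = 1 → E M a = E M b := fun a b hab =>
    cexp_congr_row w K hE (kernel_row_eq K h01 hsymm htrans hab) M
  have hEMinv' : ∀ a b, K' a b = 1 → E M a = E M b := fun a b hab => hEMinv a b (href a b hab)
  -- tower property `E (E' f) = E f`, via self-adjointness of `E'` against the `K`-row indicator
  have htower : ∀ f ω, E (E' f) ω = E f ω := by
    intro f ω
    have hinv : ∀ a b, K' a b = 1 → K ω a = K ω b := fun a b hab => by
      rw [hsymm ω a, hsymm ω b]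
      exact kernel_row_eq K h01 hsymm htrans (href a b hab) ω
    have key := sum_mul_cexp w K' hE' hw h01' hrefl' hsymm' htrans' hinv f
    have hl : ∑ ω', K ω ω' * w ω' * E' f ω' = ∑ ω', w ω' * K ω ω' * E' f ω' :=
      Finset.sum_congr rfl fun ω' _ => by ring
    have hr : ∑ ω', K ω ω' * w ω' * f ω' = ∑ ω', w ω' * K ω ω' * f ω' :=
      Finset.sum_congr rfl fun ω' _ => by ring
    rw [hE, hE, hl, hr, key]
  -- step 1: the conditional covariance is `E (D s)`
  have step1 : ∀ ω, E (fun ω => M ω * s ω) ω - E M ω * E s ω = E (fun ω => D ω * s ω) ω := by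
    intro ω
    have hfun : (fun ω => D ω * s ω) = fun ω => E' (fun ω => M ω * s ω) ω - E M ω * s ω := by
      funext ω'
      simp only [hD]
      rw [cexp_mul_of_invariant w K' hE' h01' hsinv M ω']
      ring
    rw [hfun, cexp_sub w K hE, htower]
    congr 1
    have : (fun ω => E M ω * s ω) = fun ω => s ω * E M ω := by
      funext ω'; ring
    rw [this, cexp_mul_of_invariant w K hE h01 hEMinv s ω, mul_comm]
  -- step 2: conditional Cauchy–Schwarz
  have step2 : ∀ ω, (E (fun ω => D ω * s ω) ω) ^ 2 ≤ E (fun ω => D ω ^ 2) ω := fun ω =>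
    cexp_mul_sign_sq_le w K hE hw h01 hrefl hs D ω
  -- step 3: remove the conditioning
  have step3 : ∑ ω, w ω * E (fun ω => D ω ^ 2) ω = ∑ ω, w ω * D ω ^ 2 :=
    sum_w_mul_cexp w K hE hw h01 hrefl hsymm htrans _
  -- step 4: `∑ w D² = ∑ w (E' M)² - ∑ w (E M)²`
  have h4a : ∑ ω, w ω * E M ω * E' M ω = ∑ ω, w ω * E M ω * M ω :=
    sum_mul_cexp w K' hE' hw h01' hrefl' hsymm' htrans' hEMinv' M
  have h4b : ∑ ω, w ω * E M ω * E M ω = ∑ ω, w ω * E M ω * M ω :=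
    sum_mul_cexp w K hE hw h01 hrefl hsymm htrans hEMinv M
  have hexpand : ∑ ω, w ω * D ω ^ 2 =
      ∑ ω, w ω * E' M ω ^ 2 - 2 * ∑ ω, w ω * E M ω * E' M ω + ∑ ω, w ω * E M ω * E M ω := by
    rw [Finset.mul_sum, ← Finset.sum_sub_distrib, ← Finset.sum_add_distrib]
    refine Finset.sum_congr rfl fun ω _ => ?_
    simp only [hD]
    ring
  have step4 : ∑ ω, w ω * D ω ^ 2 = ∑ ω, w ω * E' M ω ^ 2 - ∑ ω, w ω * E M ω ^ 2 := by
    have hsq : ∑ ω, w ω * E M ω ^ 2 = ∑ ω, w ω * E M ω * E M ω :=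
      Finset.sum_congr rfl fun ω _ => by ring
    rw [hexpand, hsq, h4a, ← h4b]
    ring
  -- step 5: the two expected conditional variances
  have step5 : ∑ ω, w ω * (E (fun ω => M ω ^ 2) ω - (E M ω) ^ 2) -
      ∑ ω, w ω * (E' (fun ω => M ω ^ 2) ω - (E' M ω) ^ 2) =
      ∑ ω, w ω * E' M ω ^ 2 - ∑ ω, w ω * E M ω ^ 2 := by
    rw [vbar_eq w K hE hw h01 hrefl hsymm htrans, vbar_eq w K' hE' hw h01' hrefl' hsymm' htrans']
    ring
  -- combine
  calc ∑ ω, w ω * (E (fun ω => M ω * s ω) ω - E M ω * E s ω) ^ 2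
      = ∑ ω, w ω * (E (fun ω => D ω * s ω) ω) ^ 2 :=
        Finset.sum_congr rfl fun ω _ => by rw [step1 ω]
    _ ≤ ∑ ω, w ω * E (fun ω => D ω ^ 2) ω :=
        Finset.sum_le_sum fun ω _ => mul_le_mul_of_nonneg_left (step2 ω) (hw ω).le
    _ = _ := by rw [step3, step4, step5]

end Drop

end Summit.CriticalPhenomena.Ising3DConformalLimit.PlantedPinningCeiling
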